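import Summits.BirchSwinnertonDyer.BirchSwinnertonDyer.Theorems.ByReductionTypeAtTwoFineSelmerConjAAtTwoAdditivePotGoodAscentStampsA
import HarnessLib

/-!
# C4″ `AdditivePotMultOverKAtTwo` (item stmt-BirchSwinnertonDyer-22618), the (I1M′) input of the upper half on the `Δ < 0` rows:
# KERNEL STAMPS, part L — Iwasawa's `μ₂ = 0` (ZERO hypotheses) for the `2`-torsion cubic fields `d = -20075`, `d = -22707` and UNCONDITIONAL
# statement (A) at `2` for the C4″ census curves 321200cr1, 363312bi1

Cell `bsd-2adic`, rung K4, seat `bsd-2adic-k4-w3` GEN 11 (explicit unit of director-bsd g16 (309)(7); `--supports stmt-BirchSwinnertonDyer-22618`).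
HONEST FRAMING (D-0036/D-0054/D-0152): THEOREMS ONLY (no definition, no named fact, no `sorry`). FIELD PART (unconditional kernel arithmetic about an
explicit cubic field `ℚ(θ)`; generator = eng-2's polredabs cubic when its index `[𝓞 : ℤ[θ]]` is odd, else an odd-index second generator):
`irreducible_cubic_<d>`, `odd_classNumber_of_root_<d>` (norm certificate below the Minkowski bound; k4-w1's `odd_classNumber_of_cubeCertificate`),
**`classicalMu_two_cubicField_<d>`** = `μ = 0` (growth form) along EVERY cyclotomic `ℤ₂`-extension of `ℚ(θ)` from `e₀ = 0` (odd `h`), `e₁ = 0` (k4-w1's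
Chevalley door at `2`, `layerOneBit_of_chevalleyCert`: a unit with `2`-adic image `≡ ±3 (mod 8)` is not a norm from `ℚ(θ, √2)`; ≤ 2 primes above `2`),
`n₀ = 0` (odd cubic discriminant `…_of_odd_cubic_discr`, or `2 = 𝔭𝔮²` with an even-index certificate `…_of_evenIndexCertificate`) and Fukuda 1994 Thm. 1 (1)
(`_holds`). These fields have TWO primes above `2` (the `2`-division cubic of a potentially multiplicative curve has a `ℚ₂`-root). ROW PART:
`conjA_two_<L>'` = Coates–Sujatha's statement (A) at `p = 2` for the census cubic model of the Cremona class (a-invariants of addL2x GEN 13's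
`nst_census-j313647.tsv`), PROVED OUTRIGHT: field identification `ℚ(β) = ℚ(θ)` + cruxlead-19573-w2's door
`TotallyComplexMu.conjA_two_cubicModel_of_classicalMu_of_discr_neg` (kernel Lim 3.5@2 + `ℓ = 2` ascent). Certificates (norm witnesses, fundamental units by a
relation sieve, Hensel data, even-index elements) found by the seat's exact-arithmetic tools (`work/tools/`) and CHECKED HERE by the kernel; eng-2's
census CERT-ADD-POTMULT-FUKUDA269-E2 agrees (`μ₂ = λ₂ = 0`, bnfcertify). Statement (A) is NOT BSD: BSD₂ for these curves is not proved; C4″ / (I1M′) stay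
research-open; nothing booked; no row of 22618 changes tier (pen RC-490 (4)). Pattern/toolkit: k4-w1 GEN 5–8 (`…MuTwoKernelRows{A,B}`, `…AscentStampsA`).

References: [CoatesSujatha2005] Conj. A, Thm. 3.4; [Iwasawa1973MuInvariants] Thm. 2/3; [Fukuda1994] Thm. 1 (1); [Lang1990] Ch. 13 §4 Lemma 4.1;
[Washington1997] §13.1; [Marcus1977] Ch. 5 Thm. 35–37; [Cohen1993] §6.3; [Lim2017FineSelmer] §3; cell files `eng2/fukuda269/{TABLE,LAYERS}-…-E2-v1.tsv`.
-/

set_option autoImplicit false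
-- sibling precedent (`…MuTwoKernelRowsA.lean`): the directory name repeats the summit name
set_option linter.dupNamespace false

noncomputable section
open scoped Classical IntermediateField NumberField Real nonZeroDivisors
namespace Summit.BirchSwinnertonDyer.BirchSwinnertonDyer.Theorems.AddKatoTwo
open WeierstrassCurve Field Polynomial IsDedekindDomain NumberField Matrix Literature.NumberTheory.EllipticCurves
  Literature.NumberTheory.GaloisRepresentations
  Literature.NumberTheory.IwasawaTheory
  Summit.BirchSwinnertonDyer.BirchSwinnertonDyer.Theorems.SteinbergFibreAtTwo
  Summit.BirchSwinnertonDyer.BirchSwinnertonDyer.Theorems.AlignedTransportAtTwoTorsionPointField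
  Summit.BirchSwinnertonDyer.BirchSwinnertonDyer.Theses.ByReductionTypeAtTwo

/-! ## The cubic field of discriminant `-20075` (`X³ + (-1)X² + (17)X + (2)`, index `1`; C4″ rows 321200cr1) -/

/-- `X³ + (-1)X² + (17)X + (2)` is irreducible over `ℚ` (no root mod `3`). -/
theorem irreducible_cubic_d20075n : Irreducible (Cubic.toPoly ⟨1, ((-1 : ℤ) : ℚ), ((17 : ℤ) : ℚ), ((2 : ℤ) : ℚ)⟩) :=
  haveI : Fact (Nat.Prime 3) := ⟨by norm_num⟩
  irreducible_cubic_of_no_root_zmod 3 (by decide)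

section Certd20075n

variable (K : Type) [Field K] [NumberField K]

/-- **`h` is ODD for every cubic number field whose integers contain a root `θ` of `X³ + (-1)X² + (17)X + (2)`** (`|disc| = 20075` = `|d_K|`,
`M_K < 41`): a norm certificate — for every prime `ℓ < 41` and every root `a` of the cubic mod `ℓ` a generator `x + yθ + zθ² ∈ ℤ[θ]` of norm `±ℓ`
of the ideal `I ∋ ℓ, θ − a` (coordinates `(x, y, z)`: `ℓ = 2`: `a = 0` ↦ `(0, -1, 0)`; `ℓ = 3`: no root; `ℓ = 5`: `a = 2` ↦ `(-1319, 86, -77)`; `ℓ = 7`: no root; `ℓ = 11`: `a = 5` ↦ `(-3, -25, 6)`, `a = 9` ↦ `(137, -9, 8)`; `ℓ = 13`: no root; `ℓ = 17`: `a = 5` ↦ `(-3, -32, -54)`, `a = 14` ↦ `(-1, -8, 5)`, `a = 16` ↦ `(-1, -1, 0)`; `ℓ = 19`: `a = 1` ↦ `(1, -1, 0)`; `ℓ = 23`: no root; `ℓ = 29`: no root; `ℓ = 31`: `a = 22` ↦ `(64119, -4180, 3743)`; `ℓ = 37`: no root); found by the seat's relation sieve and CHECKED HERE by the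
kernel (`pow_three_eq_span_of_cert`, `Or.inl`). eng-2's PARI value (bnfcertify): `h = 1`. KERNEL. [cite: Marcus1977, Ch. 5 Thm. 35–37 and Cor. 2] [cite: Cohen1993, §6.3] -/
theorem odd_classNumber_of_root_d20075n (h3 : Module.finrank ℚ K = 3) (b : 𝓞 K)
    (hb : b ^ 3 + (-1 : ℤ) * b ^ 2 + (17 : ℤ) * b + (2 : ℤ) = 0) : Odd (NumberField.classNumber K) := by
  have hirr := irreducible_cubic_d20075n
  have hd : |NumberField.discr K| ≤ (20075 : ℕ) :=
    (abs_discr_le_abs_cubic_discr K h3 b hirr hb).trans (by simp only [Cubic.discr]; norm_num)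
  refine odd_classNumber_of_cubeCertificate K h3 (B := 41)
    (minkowskiBound_lt_of_sqrt_le K h3 hd (s := 141.69)
      ((Real.sqrt_le_sqrt (by norm_num : ((20075 : ℕ) : ℝ) ≤ (141.69 : ℝ) ^ 2)).trans (Real.sqrt_sq (by norm_num)).le)
      (by norm_num)) ?_
  intro ℓ hℓB hℓ J hJ
  interval_cases ℓ <;> norm_num at hℓ
  · -- `ℓ = 2`: roots [0]
    refine pow_three_eq_span_of_cert K h3 b hirr hb (by norm_num) (fun a ha hdvd => ?_) hJ
    interval_cases a <;> norm_num at hdvd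
    · exact Or.inl ⟨(0), (-1), (0), 1, by norm_num, by norm_num, ⟨_, by rw [Nat.cast_one, one_mul]⟩, by norm_num⟩
  · -- `ℓ = 3`: roots []
    refine pow_three_eq_span_of_cert K h3 b hirr hb (by norm_num) (fun a ha hdvd => ?_) hJ
    interval_cases a <;> norm_num at hdvd
  · -- `ℓ = 5`: roots [2]
    refine pow_three_eq_span_of_cert K h3 b hirr hb (by norm_num) (fun a ha hdvd => ?_) hJ
    interval_cases a <;> norm_num at hdvd
    · exact Or.inl ⟨(-1319), (86), (-77), 1, by norm_num, by norm_num, ⟨_, by rw [Nat.cast_one, one_mul]⟩, by norm_num⟩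
  · -- `ℓ = 7`: roots []
    refine pow_three_eq_span_of_cert K h3 b hirr hb (by norm_num) (fun a ha hdvd => ?_) hJ
    interval_cases a <;> norm_num at hdvd
  · -- `ℓ = 11`: roots [5, 9]
    refine pow_three_eq_span_of_cert K h3 b hirr hb (by norm_num) (fun a ha hdvd => ?_) hJ
    interval_cases a <;> norm_num at hdvd
    · exact Or.inl ⟨(-3), (-25), (6), 1, by norm_num, by norm_num, ⟨_, by rw [Nat.cast_one, one_mul]⟩, by norm_num⟩
    · exact Or.inl ⟨(137), (-9), (8), 1, by norm_num, by norm_num, ⟨_, by rw [Nat.cast_one, one_mul]⟩, by norm_num⟩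
  · -- `ℓ = 13`: roots []
    refine pow_three_eq_span_of_cert K h3 b hirr hb (by norm_num) (fun a ha hdvd => ?_) hJ
    interval_cases a <;> norm_num at hdvd
  · -- `ℓ = 17`: roots [5, 14, 16]
    refine pow_three_eq_span_of_cert K h3 b hirr hb (by norm_num) (fun a ha hdvd => ?_) hJ
    interval_cases a <;> norm_num at hdvd
    · exact Or.inl ⟨(-3), (-32), (-54), 1, by norm_num, by norm_num, ⟨_, by rw [Nat.cast_one, one_mul]⟩, by norm_num⟩
    · exact Or.inl ⟨(-1), (-8), (5), 1, by norm_num, by norm_num, ⟨_, by rw [Nat.cast_one, one_mul]⟩, by norm_num⟩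
    · exact Or.inl ⟨(-1), (-1), (0), 1, by norm_num, by norm_num, ⟨_, by rw [Nat.cast_one, one_mul]⟩, by norm_num⟩
  · -- `ℓ = 19`: roots [1]
    refine pow_three_eq_span_of_cert K h3 b hirr hb (by norm_num) (fun a ha hdvd => ?_) hJ
    interval_cases a <;> norm_num at hdvd
    · exact Or.inl ⟨(1), (-1), (0), 1, by norm_num, by norm_num, ⟨_, by rw [Nat.cast_one, one_mul]⟩, by norm_num⟩
  · -- `ℓ = 23`: roots []
    refine pow_three_eq_span_of_cert K h3 b hirr hb (by norm_num) (fun a ha hdvd => ?_) hJ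
    interval_cases a <;> norm_num at hdvd
  · -- `ℓ = 29`: roots []
    refine pow_three_eq_span_of_cert K h3 b hirr hb (by norm_num) (fun a ha hdvd => ?_) hJ
    interval_cases a <;> norm_num at hdvd
  · -- `ℓ = 31`: roots [22]
    refine pow_three_eq_span_of_cert K h3 b hirr hb (by norm_num) (fun a ha hdvd => ?_) hJ
    interval_cases a <;> norm_num at hdvd
    · exact Or.inl ⟨(64119), (-4180), (3743), 1, by norm_num, by norm_num, ⟨_, by rw [Nat.cast_one, one_mul]⟩, by norm_num⟩
  · -- `ℓ = 37`: roots []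
    refine pow_three_eq_span_of_cert K h3 b hirr hb (by norm_num) (fun a ha hdvd => ?_) hJ
    interval_cases a <;> norm_num at hdvd

end Certd20075n

/-- **Iwasawa's `μ₂ = 0` for the cubic field of discriminant `-20075`** (`ℚ(θ)`, `θ³ + (-1)θ² + (17)θ + (2) = 0`; TWO primes above `2`,
`2` unramified (odd discriminant); `h` odd), KERNEL — every cyclotomic `ℤ₂`-extension of `ℚ(θ)` has `μ = 0` (growth form; indeed `e_n = 0` for all `n`).
Chevalley's door at `2` (k4-w1 `layerOneBit_of_chevalleyCert`): the unit `ε = (-466699663) + (30424750)θ + (-27243972)θ²` (regulator ≈ 19.97;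
`ε³ + (470623163)ε² + (26643)ε + (1) = 0`) has `ε ≡ 5 (mod 8)` under `θ ↦ z₂ ≡ 2` (`8 ∣ g(2)`, `g'(2)` odd), so `(ε, 2)_𝔭 = −1`: a non-norm
from `ℚ(θ, √2)`, whence `e₁ = 0`; `≤ 2` primes above `2` by `4 ∤ g(0)`, `4 ∤ g(1)`; `e₀ = 0` by `odd_classNumber_of_root_d20075n`; `n₀ = 0` because the discriminant is odd (`classicalMuVanishes_two_adjoin_of_odd_cubic_discr`); Fukuda 1994 Thm. 1 (1) (`_holds`).
The (I1M′) input of GEN 9's door for the C4″ rows 321200cr1. [cite: Fukuda1994, Thm. 1 (1), p. 264] [cite: Lang1990, Ch. 13 §4, Lemma 4.1]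
[cite: Washington1997, §13.1] [cite: Greenberg2001IwasawaPastPresent, §4 (Iwasawa's μ-conjecture)] -/
theorem classicalMu_two_cubicField_d20075n {θ : AlgebraicClosure ℚ} (hθ : aeval θ (Cubic.toPoly ⟨1, ((-1 : ℤ) : ℚ), ((17 : ℤ) : ℚ), ((2 : ℤ) : ℚ)⟩) = 0) :
    haveI : FiniteDimensional ℚ (IntermediateField.adjoin ℚ {θ}) :=
      IntermediateField.adjoin.finiteDimensional ((AlgebraicClosure.isAlgebraic ℚ).isAlgebraic θ).isIntegral
    haveI : NumberField (IntermediateField.adjoin ℚ {θ}) := NumberField.mk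
    ∀ κL : ZpExtension (IntermediateField.adjoin ℚ {θ}) 2, κL.IsCyclotomic → ClassicalMuVanishes κL := by
  intro κL hκL
  have hθ' : θ ^ 3 + (-1 : AlgebraicClosure ℚ) * θ ^ 2 + (17 : AlgebraicClosure ℚ) * θ + (2 : AlgebraicClosure ℚ) = 0 := by
    have := hθ
    simp only [Cubic.toPoly, map_one, one_mul, aeval_add, aeval_mul, aeval_C, aeval_X_pow, aeval_X,
      eq_ratCast, Rat.cast_intCast] at this
    push_cast at this
    linear_combination this
  have he : aeval (algebraMap ℚ (AlgebraicClosure ℚ) (((-466699663 : ℤ) : ℚ) / ((1 : ℤ) : ℚ)) +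
      algebraMap ℚ (AlgebraicClosure ℚ) (((30424750 : ℤ) : ℚ) / ((1 : ℤ) : ℚ)) * θ +
      algebraMap ℚ (AlgebraicClosure ℚ) (((-27243972 : ℤ) : ℚ) / ((1 : ℤ) : ℚ)) * θ ^ 2)
      (Cubic.toPoly ⟨1, ((470623163 : ℤ) : ℚ), ((26643 : ℤ) : ℚ), ((1 : ℤ) : ℚ)⟩) = 0 := by
    simp only [Cubic.toPoly, map_one, one_mul, aeval_add, aeval_mul, aeval_C, aeval_X_pow, aeval_X, eq_ratCast,
      Rat.cast_intCast, Rat.cast_div]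
    push_cast
    linear_combination ((427285972871665004425096 : AlgebraicClosure ℚ) + (-374255683447747372464816 : AlgebraicClosure ℚ) * θ + (47525450022919153145952 : AlgebraicClosure ℚ) * θ ^ 2 + (-20221402595063053866048 : AlgebraicClosure ℚ) * θ ^ 3) * hθ'
  have hh := not_two_dvd_card_classGroup_adjoin_of_forall_cubicField_odd irreducible_cubic_d20075n (odd_classNumber_of_root_d20075n) hθ
  have h1 := layerOneBit_of_chevalleyCert irreducible_cubic_d20075n hθ hh ⟨0, by norm_num⟩ ⟨0, by norm_num⟩
      (-466699663) (30424750) (-27243972) (1) (470623163) (26643) (1) (by norm_num) he (2) (1) (by norm_num) (by norm_num) (by decide) (by decide)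
  exact classicalMuVanishes_two_adjoin_of_odd_cubic_discr irreducible_cubic_d20075n (by simp only [Cubic.discr]; norm_num) hθ hh κL hκL
    (h1 κL hκL)

/-! ### Row `321200cr1` (cubic field `d = -20075`) -/

/-- The census cubic model of the C4″ row `321200cr1` (`y² = x³ + (1)x² + (-725208)x + (-247986412)`, addL2x GEN 13 `nst_census` a-invariants) is an elliptic curve. -/
theorem isElliptic_321200cr1' : (⟨0, ((1 : ℤ) : ℚ), 0, ((-725208 : ℤ) : ℚ), ((-247986412 : ℤ) : ℚ)⟩ : WeierstrassCurve ℚ).IsElliptic :=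
  isElliptic_cubicModel _ _ _ (by simp only [Cubic.discr]; norm_num)

/-- **UNCONDITIONAL (A)₂ for the C4″ census curve `321200cr1` — ZERO hypotheses, ZERO named facts** (additive potentially multiplicative at `2`,
irreducible `E[2]`, `Δ < 0`; `2`-torsion cubic field `ℚ(θ)`, `θ³ + (-1)θ² + (17)θ + (2) = 0`, `d = -20075`, `p q, f(q)=2`, `h` odd). Coates–Sujatha's
statement (A) at `p = 2` for the cubic model `y² = x³ + (1)x² + (-725208)x + (-247986412)`: for every cyclotomic `ℤ₂`-extension of `ℚ` the dual fine Selmer group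
over `ℚ_∞` is finitely generated over `ℤ₂` (`∃ γ D` currency). KERNEL: `classicalMu_two_cubicField_d20075n` above (μ₂(ℚ(θ)_cyc) = 0 for the field of `X³ + (-1)X² + (17)X + (2)`) ⟹ cruxlead-19573-w2's `ℓ = 2` ascent to the totally complex
`ℚ(E[2]) = ℚ(θ, √d)` and kernel Lim 3.5@2 (`TotallyComplexMu.conjA_two_cubicModel_of_classicalMu_of_discr_neg`); the root `β = x(T)` of the curve's cubic is
`973 + (-115)θ + (85)θ²` and `ℚ(β) = ℚ(θ)`. This discharges the (I1M′) input of this row (GEN 9 `hAnaMI_negDisc_of_cubicFieldMu`) in the kernel;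
it is statement (A), NOT BSD: BSD₂ for `321200cr1` is NOT proved by this. [cite: CoatesSujatha2005, Conj. A and Thm. 3.4]
[cite: Iwasawa1973MuInvariants, Thm. 2 and Thm. 3] [cite: Fukuda1994, Thm. 1 (1), p. 264] [cite: Lang1990, Ch. 13 §4, Lemma 4.1] -/
theorem conjA_two_321200cr1' (κ : ZpExtension ℚ 2) (hκ : κ.IsCyclotomic) :
    haveI := isElliptic_321200cr1'
    ∃ (γ : absoluteGaloisGroup ℚ) (D : (⟨0, ((1 : ℤ) : ℚ), 0, ((-725208 : ℤ) : ℚ), ((-247986412 : ℤ) : ℚ)⟩ : WeierstrassCurve ℚ).FineSelmerDualData κ γ),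
      Module.Finite ℤ_[2] (RestrictScalars ℤ_[2] (IwasawaAlgebra 2) D.X) := by
  haveI := isElliptic_321200cr1'
  obtain ⟨θ, hθ⟩ : ∃ θ : AlgebraicClosure ℚ, aeval θ (Cubic.toPoly ⟨1, ((-1 : ℤ) : ℚ), ((17 : ℤ) : ℚ), ((2 : ℤ) : ℚ)⟩) = 0 :=
    IsAlgClosed.exists_aeval_eq_zero _ _ (by rw [Cubic.degree_of_a_ne_zero one_ne_zero]; norm_num)
  have hθ' : θ ^ 3 + (-1 : AlgebraicClosure ℚ) * θ ^ 2 + (17 : AlgebraicClosure ℚ) * θ + (2 : AlgebraicClosure ℚ) = 0 := by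
    have := hθ
    simp only [Cubic.toPoly, map_one, one_mul, aeval_add, aeval_mul, aeval_C, aeval_X_pow, aeval_X,
      eq_ratCast, Rat.cast_intCast] at this
    push_cast at this
    linear_combination this
  set β : AlgebraicClosure ℚ := algebraMap ℚ (AlgebraicClosure ℚ) (973 : ℚ) +
      algebraMap ℚ (AlgebraicClosure ℚ) (-115 : ℚ) * θ + algebraMap ℚ (AlgebraicClosure ℚ) (85 : ℚ) * θ ^ 2 with hβdef
  have hβ : aeval β (Cubic.toPoly ⟨1, ((1 : ℤ) : ℚ), ((-725208 : ℤ) : ℚ), ((-247986412 : ℤ) : ℚ)⟩) = 0 := by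
    simp only [Cubic.toPoly, map_one, one_mul, aeval_add, aeval_mul, aeval_C, aeval_X_pow, aeval_X, eq_ratCast,
      Rat.cast_intCast]
    rw [hβdef]
    simp only [eq_ratCast]
    push_cast
    linear_combination ((-15749875 : AlgebraicClosure ℚ) + (12150750 : AlgebraicClosure ℚ) * θ + (-1878500 : AlgebraicClosure ℚ) * θ ^ 2 + (614125 : AlgebraicClosure ℚ) * θ ^ 3) * hθ'
  have hadj : IntermediateField.adjoin ℚ {β} = IntermediateField.adjoin ℚ {θ} := by
    apply le_antisymm
    · rw [IntermediateField.adjoin_simple_le_iff, hβdef]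
      have hθmem := IntermediateField.mem_adjoin_simple_self ℚ θ
      exact add_mem (add_mem (algebraMap_mem _ _) (mul_mem (algebraMap_mem _ _) hθmem))
        (mul_mem (algebraMap_mem _ _) (pow_mem hθmem 2))
    · rw [IntermediateField.adjoin_simple_le_iff]
      have hθeq : θ = algebraMap ℚ (AlgebraicClosure ℚ) (-4025631/256000 : ℚ) +
          algebraMap ℚ (AlgebraicClosure ℚ) (-8697/512000 : ℚ) * β +
          algebraMap ℚ (AlgebraicClosure ℚ) (17/512000 : ℚ) * β ^ 2 := by
        rw [hβdef]; simp only [eq_ratCast]; push_cast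
        linear_combination (((8381 : AlgebraicClosure ℚ) / 20480) + ((-4913 : AlgebraicClosure ℚ) / 20480) * θ) * hθ'
      rw [hθeq]
      have hβmem := IntermediateField.mem_adjoin_simple_self ℚ β
      exact add_mem (add_mem (algebraMap_mem _ _) (mul_mem (algebraMap_mem _ _) hβmem))
        (mul_mem (algebraMap_mem _ _) (pow_mem hβmem 2))
  have h3 : Module.finrank ℚ (IntermediateField.adjoin ℚ {β}) = 3 := by
    rw [hadj]; exact finrank_adjoin_eq_three_of_irreducible irreducible_cubic_d20075n hθ
  exact TotallyComplexMu.conjA_two_cubicModel_of_classicalMu_of_discr_neg (1) (-725208) (-247986412)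
    (irreducible_cubic_of_finrank_adjoin_eq_three hβ h3) (by simp only [Cubic.discr]; norm_num) hβ
    (by rw [hadj]; exact classicalMu_two_cubicField_d20075n hθ) κ hκ

/-! ## The cubic field of discriminant `-22707` (`X³ + (0)X² + (0)X + (-29)`, index `1`; C4″ rows 363312bi1) -/

/-- `X³ + (0)X² + (0)X + (-29)` is irreducible over `ℚ` (no root mod `13`). -/
theorem irreducible_cubic_d22707n : Irreducible (Cubic.toPoly ⟨1, ((0 : ℤ) : ℚ), ((0 : ℤ) : ℚ), ((-29 : ℤ) : ℚ)⟩) :=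
  haveI : Fact (Nat.Prime 13) := ⟨by norm_num⟩
  irreducible_cubic_of_no_root_zmod 13 (by decide)

section Certd22707n

variable (K : Type) [Field K] [NumberField K]

/-- **`h` is ODD for every cubic number field whose integers contain a root `θ` of `X³ + (0)X² + (0)X + (-29)`** (`|disc| = 22707` = `|d_K|`,
`M_K < 43`): a norm certificate — for every prime `ℓ < 43` and every root `a` of the cubic mod `ℓ` a generator `x + yθ + zθ² ∈ ℤ[θ]` of norm `±ℓ`
of the ideal `I ∋ ℓ, θ − a` (coordinates `(x, y, z)`: `ℓ = 2`: `a = 1` ↦ `(3, -1, 0)`; `ℓ = 3`: `a = 2` ↦ `(324876, 105743, 34418)`; `ℓ = 5`: `a = 4` ↦ `(196, -30, -11)`; `ℓ = 7`: `a = 1` ↦ `(132, 43, 14)`, `a = 2` ↦ `(-1637, 158, 122)`, `a = 4` ↦ `(5352, 1742, 567)`; `ℓ = 11`: `a = 6` ↦ `(-110301, 3292, 10614)`; `ℓ = 13`: no root; `ℓ = 17`: `a = 6` ↦ `(-2968408112, -966179037, -314478972)`; `ℓ = 19`: no root; `ℓ = 23`: `a = 8` ↦ `(26568, -1572, -2303)`;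 `ℓ = 29`: `a = 0` ↦ `(0, -1, 0)`; `ℓ = 31`: `a = 11` ↦ `(4811, -13210, 3790)`, `a = 24` ↦ `(61, -26, 2)`, `a = 27` ↦ `(177, -414, 116)`; `ℓ = 37`: `a = 17` ↦ `(521857, 79006, -81002)`, `a = 22` ↦ `(90279140782, 29384710596, 9564349077)`, `a = 35` ↦ `(-2, -1, 0)`; `ℓ = 41`: `a = 22` ↦ `(-3030198, 3228099, -729680)`); found by the seat's relation sieve and CHECKED HERE by the
kernel (`pow_three_eq_span_of_cert`, `Or.inl`). eng-2's PARI value (bnfcertify): `h = 1`. KERNEL. [cite: Marcus1977, Ch. 5 Thm. 35–37 and Cor. 2] [cite: Cohen1993, §6.3] -/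
theorem odd_classNumber_of_root_d22707n (h3 : Module.finrank ℚ K = 3) (b : 𝓞 K)
    (hb : b ^ 3 + (0 : ℤ) * b ^ 2 + (0 : ℤ) * b + (-29 : ℤ) = 0) : Odd (NumberField.classNumber K) := by
  have hirr := irreducible_cubic_d22707n
  have hd : |NumberField.discr K| ≤ (22707 : ℕ) :=
    (abs_discr_le_abs_cubic_discr K h3 b hirr hb).trans (by simp only [Cubic.discr]; norm_num)
  refine odd_classNumber_of_cubeCertificate K h3 (B := 43)
    (minkowskiBound_lt_of_sqrt_le K h3 hd (s := 150.69)
      ((Real.sqrt_le_sqrt (by norm_num : ((22707 : ℕ) : ℝ) ≤ (150.69 : ℝ) ^ 2)).trans (Real.sqrt_sq (by norm_num)).le)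
      (by norm_num)) ?_
  intro ℓ hℓB hℓ J hJ
  interval_cases ℓ <;> norm_num at hℓ
  · -- `ℓ = 2`: roots [1]
    refine pow_three_eq_span_of_cert K h3 b hirr hb (by norm_num) (fun a ha hdvd => ?_) hJ
    interval_cases a <;> norm_num at hdvd
    · exact Or.inl ⟨(3), (-1), (0), 1, by norm_num, by norm_num, ⟨_, by rw [Nat.cast_one, one_mul]⟩, by norm_num⟩
  · -- `ℓ = 3`: roots [2]
    refine pow_three_eq_span_of_cert K h3 b hirr hb (by norm_num) (fun a ha hdvd => ?_) hJ
    interval_cases a <;> norm_num at hdvd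
    · exact Or.inl ⟨(324876), (105743), (34418), 1, by norm_num, by norm_num, ⟨_, by rw [Nat.cast_one, one_mul]⟩, by norm_num⟩
  · -- `ℓ = 5`: roots [4]
    refine pow_three_eq_span_of_cert K h3 b hirr hb (by norm_num) (fun a ha hdvd => ?_) hJ
    interval_cases a <;> norm_num at hdvd
    · exact Or.inl ⟨(196), (-30), (-11), 1, by norm_num, by norm_num, ⟨_, by rw [Nat.cast_one, one_mul]⟩, by norm_num⟩
  · -- `ℓ = 7`: roots [1, 2, 4]
    refine pow_three_eq_span_of_cert K h3 b hirr hb (by norm_num) (fun a ha hdvd => ?_) hJ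
    interval_cases a <;> norm_num at hdvd
    · exact Or.inl ⟨(132), (43), (14), 1, by norm_num, by norm_num, ⟨_, by rw [Nat.cast_one, one_mul]⟩, by norm_num⟩
    · exact Or.inl ⟨(-1637), (158), (122), 1, by norm_num, by norm_num, ⟨_, by rw [Nat.cast_one, one_mul]⟩, by norm_num⟩
    · exact Or.inl ⟨(5352), (1742), (567), 1, by norm_num, by norm_num, ⟨_, by rw [Nat.cast_one, one_mul]⟩, by norm_num⟩
  · -- `ℓ = 11`: roots [6]
    refine pow_three_eq_span_of_cert K h3 b hirr hb (by norm_num) (fun a ha hdvd => ?_) hJ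
    interval_cases a <;> norm_num at hdvd
    · exact Or.inl ⟨(-110301), (3292), (10614), 1, by norm_num, by norm_num, ⟨_, by rw [Nat.cast_one, one_mul]⟩, by norm_num⟩
  · -- `ℓ = 13`: roots []
    refine pow_three_eq_span_of_cert K h3 b hirr hb (by norm_num) (fun a ha hdvd => ?_) hJ
    interval_cases a <;> norm_num at hdvd
  · -- `ℓ = 17`: roots [6]
    refine pow_three_eq_span_of_cert K h3 b hirr hb (by norm_num) (fun a ha hdvd => ?_) hJ
    interval_cases a <;> norm_num at hdvd
    · exact Or.inl ⟨(-2968408112), (-966179037), (-314478972), 1, by norm_num, by norm_num, ⟨_, by rw [Nat.cast_one, one_mul]⟩, by norm_num⟩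
  · -- `ℓ = 19`: roots []
    refine pow_three_eq_span_of_cert K h3 b hirr hb (by norm_num) (fun a ha hdvd => ?_) hJ
    interval_cases a <;> norm_num at hdvd
  · -- `ℓ = 23`: roots [8]
    refine pow_three_eq_span_of_cert K h3 b hirr hb (by norm_num) (fun a ha hdvd => ?_) hJ
    interval_cases a <;> norm_num at hdvd
    · exact Or.inl ⟨(26568), (-1572), (-2303), 1, by norm_num, by norm_num, ⟨_, by rw [Nat.cast_one, one_mul]⟩, by norm_num⟩
  · -- `ℓ = 29`: roots [0]
    refine pow_three_eq_span_of_cert K h3 b hirr hb (by norm_num) (fun a ha hdvd => ?_) hJ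
    interval_cases a <;> norm_num at hdvd
    · exact Or.inl ⟨(0), (-1), (0), 1, by norm_num, by norm_num, ⟨_, by rw [Nat.cast_one, one_mul]⟩, by norm_num⟩
  · -- `ℓ = 31`: roots [11, 24, 27]
    refine pow_three_eq_span_of_cert K h3 b hirr hb (by norm_num) (fun a ha hdvd => ?_) hJ
    interval_cases a <;> norm_num at hdvd
    · exact Or.inl ⟨(4811), (-13210), (3790), 1, by norm_num, by norm_num, ⟨_, by rw [Nat.cast_one, one_mul]⟩, by norm_num⟩
    · exact Or.inl ⟨(61), (-26), (2), 1, by norm_num, by norm_num, ⟨_, by rw [Nat.cast_one, one_mul]⟩, by norm_num⟩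
    · exact Or.inl ⟨(177), (-414), (116), 1, by norm_num, by norm_num, ⟨_, by rw [Nat.cast_one, one_mul]⟩, by norm_num⟩
  · -- `ℓ = 37`: roots [17, 22, 35]
    refine pow_three_eq_span_of_cert K h3 b hirr hb (by norm_num) (fun a ha hdvd => ?_) hJ
    interval_cases a <;> norm_num at hdvd
    · exact Or.inl ⟨(521857), (79006), (-81002), 1, by norm_num, by norm_num, ⟨_, by rw [Nat.cast_one, one_mul]⟩, by norm_num⟩
    · exact Or.inl ⟨(90279140782), (29384710596), (9564349077), 1, by norm_num, by norm_num, ⟨_, by rw [Nat.cast_one, one_mul]⟩, by norm_num⟩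
    · exact Or.inl ⟨(-2), (-1), (0), 1, by norm_num, by norm_num, ⟨_, by rw [Nat.cast_one, one_mul]⟩, by norm_num⟩
  · -- `ℓ = 41`: roots [22]
    refine pow_three_eq_span_of_cert K h3 b hirr hb (by norm_num) (fun a ha hdvd => ?_) hJ
    interval_cases a <;> norm_num at hdvd
    · exact Or.inl ⟨(-3030198), (3228099), (-729680), 1, by norm_num, by norm_num, ⟨_, by rw [Nat.cast_one, one_mul]⟩, by norm_num⟩

end Certd22707n

/-- **Iwasawa's `μ₂ = 0` for the cubic field of discriminant `-22707`** (`ℚ(θ)`, `θ³ + (0)θ² + (0)θ + (-29) = 0`; TWO primes above `2`,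
`2` unramified (odd discriminant); `h` odd), KERNEL — every cyclotomic `ℤ₂`-extension of `ℚ(θ)` has `μ = 0` (growth form; indeed `e_n = 0` for all `n`).
Chevalley's door at `2` (k4-w1 `layerOneBit_of_chevalleyCert`): the unit `ε = (-102866541757601689) + (-33481749309704842)θ + (-10897883001448120)θ²` (regulator ≈ 40.27;
`ε³ + (308599625272805067)ε² + (-967384317)ε + (1) = 0`) has `ε ≡ 5 (mod 8)` under `θ ↦ z₂ ≡ 5` (`8 ∣ g(5)`, `g'(5)` odd), so `(ε, 2)_𝔭 = −1`: a non-norm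
from `ℚ(θ, √2)`, whence `e₁ = 0`; `≤ 2` primes above `2` by `4 ∤ g(0)`, `4 ∤ g(3)`; `e₀ = 0` by `odd_classNumber_of_root_d22707n`; `n₀ = 0` because the discriminant is odd (`classicalMuVanishes_two_adjoin_of_odd_cubic_discr`); Fukuda 1994 Thm. 1 (1) (`_holds`).
The (I1M′) input of GEN 9's door for the C4″ rows 363312bi1. [cite: Fukuda1994, Thm. 1 (1), p. 264] [cite: Lang1990, Ch. 13 §4, Lemma 4.1]
[cite: Washington1997, §13.1] [cite: Greenberg2001IwasawaPastPresent, §4 (Iwasawa's μ-conjecture)] -/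
theorem classicalMu_two_cubicField_d22707n {θ : AlgebraicClosure ℚ} (hθ : aeval θ (Cubic.toPoly ⟨1, ((0 : ℤ) : ℚ), ((0 : ℤ) : ℚ), ((-29 : ℤ) : ℚ)⟩) = 0) :
    haveI : FiniteDimensional ℚ (IntermediateField.adjoin ℚ {θ}) :=
      IntermediateField.adjoin.finiteDimensional ((AlgebraicClosure.isAlgebraic ℚ).isAlgebraic θ).isIntegral
    haveI : NumberField (IntermediateField.adjoin ℚ {θ}) := NumberField.mk
    ∀ κL : ZpExtension (IntermediateField.adjoin ℚ {θ}) 2, κL.IsCyclotomic → ClassicalMuVanishes κL := by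
  intro κL hκL
  have hθ' : θ ^ 3 + (0 : AlgebraicClosure ℚ) * θ ^ 2 + (0 : AlgebraicClosure ℚ) * θ + (-29 : AlgebraicClosure ℚ) = 0 := by
    have := hθ
    simp only [Cubic.toPoly, map_one, one_mul, aeval_add, aeval_mul, aeval_C, aeval_X_pow, aeval_X,
      eq_ratCast, Rat.cast_intCast] at this
    push_cast at this
    linear_combination this
  have he : aeval (algebraMap ℚ (AlgebraicClosure ℚ) (((-102866541757601689 : ℤ) : ℚ) / ((1 : ℤ) : ℚ)) +
      algebraMap ℚ (AlgebraicClosure ℚ) (((-33481749309704842 : ℤ) : ℚ) / ((1 : ℤ) : ℚ)) * θ +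
      algebraMap ℚ (AlgebraicClosure ℚ) (((-10897883001448120 : ℤ) : ℚ) / ((1 : ℤ) : ℚ)) * θ ^ 2)
      (Cubic.toPoly ⟨1, ((308599625272805067 : ℤ) : ℚ), ((-967384317 : ℤ) : ℚ), ((1 : ℤ) : ℚ)⟩) = 0 := by
    simp only [Cubic.toPoly, map_one, one_mul, aeval_add, aeval_mul, aeval_C, aeval_X_pow, aeval_X, eq_ratCast,
      Rat.cast_intCast, Rat.cast_div]
    push_cast
    linear_combination ((-75067925915366339040890850949915470768449437427688 : AlgebraicClosure ℚ) + (-36650480813583695261224606442325283826909091803040 : AlgebraicClosure ℚ) * θ + (-11929264751333723962636084195941180037101628694400 : AlgebraicClosure ℚ) * θ ^ 2 + (-1294274584747695500705014690843621807867995328000 : AlgebraicClosure ℚ) * θ ^ 3) * hθ'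
  have hh := not_two_dvd_card_classGroup_adjoin_of_forall_cubicField_odd irreducible_cubic_d22707n (odd_classNumber_of_root_d22707n) hθ
  have h1 := layerOneBit_of_chevalleyCert irreducible_cubic_d22707n hθ hh ⟨0, by norm_num⟩ ⟨1, by norm_num⟩
      (-102866541757601689) (-33481749309704842) (-10897883001448120) (1) (308599625272805067) (-967384317) (1) (by norm_num) he (5) (1) (by norm_num) (by norm_num) (by decide) (by decide)
  exact classicalMuVanishes_two_adjoin_of_odd_cubic_discr irreducible_cubic_d22707n (by simp only [Cubic.discr]; norm_num) hθ hh κL hκL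
    (h1 κL hκL)

/-! ### Row `363312bi1` (cubic field `d = -22707`) -/

/-- The census cubic model of the C4″ row `363312bi1` (`y² = x³ + (0)x² + (-3292515)x + (-2940874398)`, addL2x GEN 13 `nst_census` a-invariants) is an elliptic curve. -/
theorem isElliptic_363312bi1' : (⟨0, ((0 : ℤ) : ℚ), 0, ((-3292515 : ℤ) : ℚ), ((-2940874398 : ℤ) : ℚ)⟩ : WeierstrassCurve ℚ).IsElliptic :=
  isElliptic_cubicModel _ _ _ (by simp only [Cubic.discr]; norm_num)

/-- **UNCONDITIONAL (A)₂ for the C4″ census curve `363312bi1` — ZERO hypotheses, ZERO named facts** (additive potentially multiplicative at `2`,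
irreducible `E[2]`, `Δ < 0`; `2`-torsion cubic field `ℚ(θ)`, `θ³ + (0)θ² + (0)θ + (-29) = 0`, `d = -22707`, `p q, f(q)=2`, `h` odd). Coates–Sujatha's
statement (A) at `p = 2` for the cubic model `y² = x³ + (0)x² + (-3292515)x + (-2940874398)`: for every cyclotomic `ℤ₂`-extension of `ℚ` the dual fine Selmer group
over `ℚ_∞` is finitely generated over `ℤ₂` (`∃ γ D` currency). KERNEL: `classicalMu_two_cubicField_d22707n` above (μ₂(ℚ(θ)_cyc) = 0 for the field of `X³ + (0)X² + (0)X + (-29)`) ⟹ cruxlead-19573-w2's `ℓ = 2` ascent to the totally complex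
`ℚ(E[2]) = ℚ(θ, √d)` and kernel Lim 3.5@2 (`TotallyComplexMu.conjA_two_cubicModel_of_classicalMu_of_discr_neg`); the root `β = x(T)` of the curve's cubic is
`0 + (435)θ + (87)θ²` and `ℚ(β) = ℚ(θ)`. This discharges the (I1M′) input of this row (GEN 9 `hAnaMI_negDisc_of_cubicFieldMu`) in the kernel;
it is statement (A), NOT BSD: BSD₂ for `363312bi1` is NOT proved by this. [cite: CoatesSujatha2005, Conj. A and Thm. 3.4]
[cite: Iwasawa1973MuInvariants, Thm. 2 and Thm. 3] [cite: Fukuda1994, Thm. 1 (1), p. 264] [cite: Lang1990, Ch. 13 §4, Lemma 4.1] -/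
theorem conjA_two_363312bi1' (κ : ZpExtension ℚ 2) (hκ : κ.IsCyclotomic) :
    haveI := isElliptic_363312bi1'
    ∃ (γ : absoluteGaloisGroup ℚ) (D : (⟨0, ((0 : ℤ) : ℚ), 0, ((-3292515 : ℤ) : ℚ), ((-2940874398 : ℤ) : ℚ)⟩ : WeierstrassCurve ℚ).FineSelmerDualData κ γ),
      Module.Finite ℤ_[2] (RestrictScalars ℤ_[2] (IwasawaAlgebra 2) D.X) := by
  haveI := isElliptic_363312bi1'
  obtain ⟨θ, hθ⟩ : ∃ θ : AlgebraicClosure ℚ, aeval θ (Cubic.toPoly ⟨1, ((0 : ℤ) : ℚ), ((0 : ℤ) : ℚ), ((-29 : ℤ) : ℚ)⟩) = 0 :=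
    IsAlgClosed.exists_aeval_eq_zero _ _ (by rw [Cubic.degree_of_a_ne_zero one_ne_zero]; norm_num)
  have hθ' : θ ^ 3 + (0 : AlgebraicClosure ℚ) * θ ^ 2 + (0 : AlgebraicClosure ℚ) * θ + (-29 : AlgebraicClosure ℚ) = 0 := by
    have := hθ
    simp only [Cubic.toPoly, map_one, one_mul, aeval_add, aeval_mul, aeval_C, aeval_X_pow, aeval_X,
      eq_ratCast, Rat.cast_intCast] at this
    push_cast at this
    linear_combination this
  set β : AlgebraicClosure ℚ := algebraMap ℚ (AlgebraicClosure ℚ) (0 : ℚ) +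
      algebraMap ℚ (AlgebraicClosure ℚ) (435 : ℚ) * θ + algebraMap ℚ (AlgebraicClosure ℚ) (87 : ℚ) * θ ^ 2 with hβdef
  have hβ : aeval β (Cubic.toPoly ⟨1, ((0 : ℤ) : ℚ), ((-3292515 : ℤ) : ℚ), ((-2940874398 : ℤ) : ℚ)⟩) = 0 := by
    simp only [Cubic.toPoly, map_one, one_mul, aeval_add, aeval_mul, aeval_C, aeval_X_pow, aeval_X, eq_ratCast,
      Rat.cast_intCast]
    rw [hβdef]
    simp only [eq_ratCast]
    push_cast
    linear_combination ((101409462 : AlgebraicClosure ℚ) + (49387725 : AlgebraicClosure ℚ) * θ + (9877545 : AlgebraicClosure ℚ) * θ ^ 2 + (658503 : AlgebraicClosure ℚ) * θ ^ 3) * hθ'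
  have hadj : IntermediateField.adjoin ℚ {β} = IntermediateField.adjoin ℚ {θ} := by
    apply le_antisymm
    · rw [IntermediateField.adjoin_simple_le_iff, hβdef]
      have hθmem := IntermediateField.mem_adjoin_simple_self ℚ θ
      exact add_mem (add_mem (algebraMap_mem _ _) (mul_mem (algebraMap_mem _ _) hθmem))
        (mul_mem (algebraMap_mem _ _) (pow_mem hθmem 2))
    · rw [IntermediateField.adjoin_simple_le_iff]
      have hθeq : θ = algebraMap ℚ (AlgebraicClosure ℚ) (145/48 : ℚ) +
          algebraMap ℚ (AlgebraicClosure ℚ) (25/8352 : ℚ) * β +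
          algebraMap ℚ (AlgebraicClosure ℚ) (-1/726624 : ℚ) * β ^ 2 := by
        rw [hβdef]; simp only [eq_ratCast]; push_cast
        linear_combination (((5 : AlgebraicClosure ℚ) / 48) + ((1 : AlgebraicClosure ℚ) / 96) * θ) * hθ'
      rw [hθeq]
      have hβmem := IntermediateField.mem_adjoin_simple_self ℚ β
      exact add_mem (add_mem (algebraMap_mem _ _) (mul_mem (algebraMap_mem _ _) hβmem))
        (mul_mem (algebraMap_mem _ _) (pow_mem hβmem 2))
  have h3 : Module.finrank ℚ (IntermediateField.adjoin ℚ {β}) = 3 := by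
    rw [hadj]; exact finrank_adjoin_eq_three_of_irreducible irreducible_cubic_d22707n hθ
  exact TotallyComplexMu.conjA_two_cubicModel_of_classicalMu_of_discr_neg (0) (-3292515) (-2940874398)
    (irreducible_cubic_of_finrank_adjoin_eq_three hβ h3) (by simp only [Cubic.discr]; norm_num) hβ
    (by rw [hadj]; exact classicalMu_two_cubicField_d22707n hθ) κ hκ
end Summit.BirchSwinnertonDyer.BirchSwinnertonDyer.Theorems.AddKatoTwo

end
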